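import Mathlib
import Summits.KontsevichZagierPeriods.Zeta5Search.Families.CellularBZRayGrowthConstantsB
import Summits.KontsevichZagierPeriods.Zeta5Search.Brown8.RayQRateLimit
import HarnessLib

/-!
# ζ(5) search — both Brown–Zudilin rates AS LIMITS for the census candidates #1, #5, H1 (fam-brown8 g8)

HONEST FRAMING: systematic search; no irrationality claim unless certified. Sizes of the linear forms of the general
family of [Brown–Zudilin 2022] (arXiv:2210.03391) on three rays singled out by the cell's census; nothing here bears on
`ζ(5)`, and none of these rays is claimed to improve on the record.

OUR work (Summit side). A generic non-vanishing criterion for `Q(p;q)` of (17) — ONE lattice point of the box at which all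
seven binomials are genuine (`Qcoeff_ne_zero_of_valid`: fourteen integer inequalities, `decide`; no evaluation of `Q`) — and, for the census directions
`#1 = (18,32,23,30,28,38,43,30)`, `#5 = (11,19,14,18,17,23,26,18)`, `H1 = (7,13,9,12,11,15,17,12)` (`dirC1`, `dirC5`, `dirH1` of
`Families/CellularBZRayGrowthConstantsB`):
* decay: `log|I(n·a)|/n → c` with `exp c = bzSup a` in the kernel-certified enclosure of that file (relative width ≤ 1.5·10⁻⁷;
  `log bzSup = −150.1560052…, −90.8993651…, −59.2409312…`), by the tree's sup-of-integrand law;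
* growth: `lim log|Q(n·a)|/n` EXISTS (`Brown8/RayQRateLimit`: supermultiplicativity of (17) + Fekete); no window is claimed
  (no two-sided `Q`-certificate has been run on these rays).
-/

noncomputable section

open Finset Real Filter Topology

namespace Summit.KontsevichZagierPeriods.Zeta5Search.Brown8

open Summit.KontsevichZagierPeriods.Zeta5Search.BinomialSum
open Literature.NumberTheory.Irrationality
open Literature.NumberTheory.Irrationality.BrownZudilin2022 (zchoose Qcoeff QOf pOf qOf Converges cellularIntegral)
open Summit.KontsevichZagierPeriods.Zeta5Search.Families.Cellular

/-! ### Non-vanishing of `Q(p;q)` from one genuine lattice term -/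

/-- A genuine integer binomial is positive. -/
theorem zchoose_pos_of {N K : ℤ} (h : 0 ≤ K ∧ K ≤ N) : 0 < zchoose N K := by
  obtain ⟨n, hn⟩ := Int.eq_ofNat_of_zero_le (h.1.trans h.2)
  obtain ⟨k, hk⟩ := Int.eq_ofNat_of_zero_le h.1
  have hkn : k ≤ n := by subst hn hk; exact_mod_cast h.2
  rw [zchoose_cast_eq hn hk hkn]
  exact_mod_cast Nat.choose_pos hkn

/-- A summand of (17) whose seven binomials are genuine (`0 ≤ K ≤ N` for each `C(N,K)`) is positive. -/
theorem qTerm_pos_of_valid {p : Fin 7 → ℤ} {q : Fin 5 → ℤ} {k₁ k₂ : ℤ}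
    (h : (0 ≤ p 0 ∧ p 0 ≤ k₁) ∧ (0 ≤ p 6 ∧ p 6 ≤ k₂) ∧
      (0 ≤ p 3 + q 2 - p 0 - p 6 ∧ p 3 + q 2 - p 0 - p 6 ≤ k₁ + k₂ + q 2 - p 0 - p 6) ∧
      (0 ≤ k₁ - p 1 ∧ k₁ - p 1 ≤ q 0) ∧ (0 ≤ k₁ - p 2 ∧ k₁ - p 2 ≤ q 1) ∧
      (0 ≤ k₂ - p 4 ∧ k₂ - p 4 ≤ q 3) ∧ (0 ≤ k₂ - p 5 ∧ k₂ - p 5 ≤ q 4)) :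
    0 < qTerm p q k₁ k₂ := by
  obtain ⟨h0, h6, h3, h1, h2, h4, h5⟩ := h
  unfold qTerm
  have := zchoose_pos_of h0; have := zchoose_pos_of h6; have := zchoose_pos_of h3; have := zchoose_pos_of h1
  have := zchoose_pos_of h2; have := zchoose_pos_of h4; have := zchoose_pos_of h5
  positivity

/-- **`Q(p;q) ≠ 0`** as soon as ONE point `(k₁,k₂)` of the box `[p₁, p₁+q₁] × [p₄, p₄+q₄]` carries a genuine term (all
summands are `≥ 0`). -/
theorem Qcoeff_ne_zero_of_valid (p : Fin 7 → ℤ) (q : Fin 5 → ℤ) {k₁ k₂ : ℤ}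
    (hk₁ : k₁ ∈ Icc (p 1) (p 1 + q 0)) (hk₂ : k₂ ∈ Icc (p 4) (p 4 + q 3))
    (h : (0 ≤ p 0 ∧ p 0 ≤ k₁) ∧ (0 ≤ p 6 ∧ p 6 ≤ k₂) ∧
      (0 ≤ p 3 + q 2 - p 0 - p 6 ∧ p 3 + q 2 - p 0 - p 6 ≤ k₁ + k₂ + q 2 - p 0 - p 6) ∧
      (0 ≤ k₁ - p 1 ∧ k₁ - p 1 ≤ q 0) ∧ (0 ≤ k₁ - p 2 ∧ k₁ - p 2 ≤ q 1) ∧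
      (0 ≤ k₂ - p 4 ∧ k₂ - p 4 ≤ q 3) ∧ (0 ≤ k₂ - p 5 ∧ k₂ - p 5 ≤ q 4)) :
    Qcoeff p q ≠ 0 := by
  have hle := qTerm_le_abs_Qcoeff p q hk₁ hk₂
  have hpos : (0 : ℝ) < (qTerm p q k₁ k₂ : ℝ) := by exact_mod_cast qTerm_pos_of_valid h
  have hne : (Qcoeff p q : ℝ) ≠ 0 := (abs_pos.mp (hpos.trans_le hle))
  exact_mod_cast hne

/-! ### The three census directions -/

/-- `Q(#1) ≠ 0` (genuine term at `(55, 53)`). -/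
theorem QOf_c1_ne_zero : QOf dirC1 ≠ 0 :=
  Qcoeff_ne_zero_of_valid (pOf dirC1) (qOf dirC1) (k₁ := 55) (k₂ := 53) (by decide) (by decide) (by decide)

/-- `Q(#5) ≠ 0` (genuine term at `(33, 32)`). -/
theorem QOf_c5_ne_zero : QOf dirC5 ≠ 0 :=
  Qcoeff_ne_zero_of_valid (pOf dirC5) (qOf dirC5) (k₁ := 33) (k₂ := 32) (by decide) (by decide) (by decide)

/-- `Q(H1) ≠ 0` (genuine term at `(22, 21)`). -/
theorem QOf_hh1_ne_zero : QOf dirH1 ≠ 0 :=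
  Qcoeff_ne_zero_of_valid (pOf dirH1) (qOf dirH1) (k₁ := 22) (k₂ := 21) (by decide) (by decide) (by decide)

/-- Decay clause for a direction in the cone with a certified enclosure of `bzSup`. -/
theorem rate_integral_of_enclosure {a : Fin 8 → ℤ} (ha : Converges a) {L U : ℝ} (hI : bzSup a ∈ Set.Icc L U) :
    ∃ c : ℝ, Real.exp c ∈ Set.Icc L U ∧
      Tendsto (fun n : ℕ => Real.log |cellularIntegral (fun i => (n : ℤ) * a i)| / n) atTop (𝓝 c) := by
  have ht := tendsto_log_cellularIntegral_div ha
  refine ⟨Real.log (bzSup a), ?_, ht.congr fun n => ?_⟩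
  · rw [Real.exp_log (bzSup_pos ha)]; exact hI
  · rw [abs_of_pos (cellularIntegral_pos_of_converges (converges_smul ha (Int.natCast_nonneg n)))]

/-- **Census #1, `a = (18,32,23,30,28,38,43,30)`: both rates as limits** (`log bzSup a = −150.1560052…`). -/
theorem c1_rates :
    (∃ c : ℝ, Real.exp c ∈ Set.Icc ((6138687168084 : ℝ) / 10 ^ 78) ((61386873666531 : ℝ) / 10 ^ 79) ∧
      Tendsto (fun n : ℕ => Real.log |cellularIntegral
        (fun i => (n : ℤ) * (![18, 32, 23, 30, 28, 38, 43, 30] : Fin 8 → ℤ) i)| / n) atTop (𝓝 c)) ∧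
    (∃ c : ℝ, Tendsto (fun n : ℕ => Real.log |(QOf
        (fun i => (n : ℤ) * (![18, 32, 23, 30, 28, 38, 43, 30] : Fin 8 → ℤ) i) : ℝ)| / n) atTop (𝓝 c)) :=
  ⟨rate_integral_of_enclosure converges_c1 bzSup_c1_mem_Icc,
    tendsto_log_abs_QOf_ray_of_converges dirC1 converges_c1 QOf_c1_ne_zero⟩

/-- **Census #5, `a = (11,19,14,18,17,23,26,18)`: both rates as limits** (`log bzSup a = −90.8993651…`). -/
theorem c5_rates :
    (∃ c : ℝ, Real.exp c ∈ Set.Icc ((3333552865989 : ℝ) / 10 ^ 52) ((33335531365304 : ℝ) / 10 ^ 53) ∧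
      Tendsto (fun n : ℕ => Real.log |cellularIntegral
        (fun i => (n : ℤ) * (![11, 19, 14, 18, 17, 23, 26, 18] : Fin 8 → ℤ) i)| / n) atTop (𝓝 c)) ∧
    (∃ c : ℝ, Tendsto (fun n : ℕ => Real.log |(QOf
        (fun i => (n : ℤ) * (![11, 19, 14, 18, 17, 23, 26, 18] : Fin 8 → ℤ) i) : ℝ)| / n) atTop (𝓝 c)) :=
  ⟨rate_integral_of_enclosure converges_c5 bzSup_c5_mem_Icc,
    tendsto_log_abs_QOf_ray_of_converges dirC5 converges_c5 QOf_c5_ne_zero⟩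

/-- **Census H1, `a = (7,13,9,12,11,15,17,12)`: both rates as limits** (`log bzSup a = −59.2409312…`). -/
theorem hh1_rates :
    (∃ c : ℝ, Real.exp c ∈ Set.Icc ((187064104195 : ℝ) / 10 ^ 37) ((18706413223883 : ℝ) / 10 ^ 39) ∧
      Tendsto (fun n : ℕ => Real.log |cellularIntegral
        (fun i => (n : ℤ) * (![7, 13, 9, 12, 11, 15, 17, 12] : Fin 8 → ℤ) i)| / n) atTop (𝓝 c)) ∧
    (∃ c : ℝ, Tendsto (fun n : ℕ => Real.log |(QOf
        (fun i => (n : ℤ) * (![7, 13, 9, 12, 11, 15, 17, 12] : Fin 8 → ℤ) i) : ℝ)| / n) atTop (𝓝 c)) :=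
  ⟨rate_integral_of_enclosure converges_hh1 bzSup_hh1_mem_Icc,
    tendsto_log_abs_QOf_ray_of_converges dirH1 converges_hh1 QOf_hh1_ne_zero⟩

end Summit.KontsevichZagierPeriods.Zeta5Search.Brown8
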